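import Summits.ABC.IUTFork.Cor312SlotLicenceNormConstK
import Summits.ABC.IUTFork.Cor312ThetaSideSlotTransportK
import Summits.ABC.IUTFork.LDHWitness
import HarnessLib

/-!
# [IUTchIII] Cor. 3.12, Step (xi-f) on the K line — readings (P) and (U) AGREE AT THE LICENCE LEVEL AT EVERY DATUM OF DEGREE ONE
# (`[F_mod : ℚ] = 1`, every rational point), for ANY realising Θ-ideles: the `hΘ` of `Cor312SlotLicenceNormConstK` DISCHARGED there

PROOF-ONLY file (D-0012; no definitions, no `Prop` facts, no instances) of the abc-iut cell (branch C certificate seat abc-iut-C-cert-2 gen 4; row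
«P:K-SLOT-LICENCE-EXACT», corollary 2). TAKES NO SIDE on [IUTchIII] Cor. 3.12 (kurims manuscript p. 173–174; Step (x) p. 181, Step (xi-f) p. 184)
or on the reading (U)/(P).

This seat's `slotLicence_iff_licence_settingPrVolSharp_of_norm_const` (p475870) says: at abc-iut-c312-7's K-level setting the (P) SLOT licence and the
(U) licence coincide as soon as the Θ-idele norms `‖t_{i,w}‖` are constant over the places `w` of the base field over each rational prime (`hΘ`,
stated there, not discharged). HERE `hΘ` IS DISCHARGED for the objects of the certificates: for initial Θ-data `D` (fields `F ⊆ K`, curve `E`,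
`F_mod = fieldOfModuli E`) and ANY Θ-ideles `t` over `K` REALISING the Θ-pilot divisor of `pilotDataOfK D K` in Dupuy–Hilado's normalisation
(the `hT` binder of abc-iut-c312-7 / abc-iut-C-cert-3's chosen ideles `exists_realising_thetaIdeles_pilotDataOfK`), abc-iut-s2-p7's
`Cor312Prov.norm_eq_norm_tΘ_of_realising` gives `‖t_{i,w}‖ = ‖t_{Θ,i,v̲}‖` with `v̲` the place of `F_mod` below `w`; when `[F_mod : ℚ] = 1`
there is ONE place of `F_mod` over `p` (abc-iut-c312-d1 `ValLine.placesOver_subsingleton_of_finrank_eq_one`), so the norms are constant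
over `w | p`:

* **`Cor312Prov.norm_realising_eq_of_finrank_eq_one`** — `‖t pp i x‖ = ‖t pp i y‖` for all `x, y` in the fibre over `pp` (given idele data
  `r` of `D`; `_of_isVolumeInputOf`: given any volume input OF `D`, e.g. a genuine Θ-volume datum's);
* **`Cor312Prov.slotLicence_iff_licence_settingPrVolSharp_pilotDataOfK_of_finrank_eq_one`** — at the K-level setting of `pilotDataOfK D K`
  with ANY context binders, ANY q-ideles and ANY realising Θ-ideles: `SlotLicence ↔ Thm311ToCor312.Licence`; contrapositive
  **`Cor312Prov.not_licence_of_not_slotLicence_settingPrVolSharp_pilotDataOfK_of_finrank_eq_one`** (so, at every datum over a rational point,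
  the antecedent `¬SlotLicence` of the K γ binders hNumPOff/hNumPOffBad/hNumPOffC — abc-iut-w5-d167 p462484/p462946 — coincides with the
  failure of the (U) licence, which the q-pinned S_H implies by abc-iut-w5-d068 `licence_of_pilotKummerCompatHull`).

HONEST SCOPE: equalities/equivalences about OUR typed objects at degree one; at `d_mod ≥ 2` the two licences can differ (the norms vary with
the place of `F_mod` below); nothing here bears on the printed GLOBAL inequality or takes a side on any author; decided-as-typed ≠ in print;
typed ≠ proved (these: proved). [cite: Mochizuki2012, IUTchIII Cor. 3.12 p. 173–174, Step (x) p. 181, Step (xi-f) p. 184; IUTchI Def. 3.1 (b)(e)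
p. 61–62, Ex. 3.2 (iv) p. 71] [cite: DupuyHilado2025, §3.4, §3.9, §4.11–4.12] [cite: CasselsFrohlichANT1967, Ch. VII Prop. 1.2 (ii)]
[claim: Mochizuki2012, status: disputed] for every IUT sentence quoted.
-/

noncomputable section

open Set Function NumberField IsDedekindDomain
open scoped Pointwise

namespace Summit.ABC.IUTFork.Cor312Prov

open Cor312 Cor312Vol Literature.IUT.LogThetaLattice Literature.IUT.LogVolume
  Literature.IUT.HodgeTheaters Literature.IUT.LogVolume.ThetaData Literature.NumberTheory.NumberFields
  Literature.NumberTheory.GaloisRepresentations.Ultrametric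
open Thm311.Real hiding finBelow

variable {F K Fbar : Type} [Field F] [NumberField F] [Field K] [NumberField K] [Algebra F K] [Field Fbar]
  [Algebra F Fbar] [Algebra K Fbar] {E : WeierstrassCurve F} [E.IsElliptic] {l : ℕ} {Pb : BadPlacePredicates K}
  (D : InitialThetaData F K Fbar E l Pb)
  (t : ∀ (pp : Nat.Primes) (_ : Fin (pilotDataOfK D K).lstar) (x : (thetaIndex (pilotDataOfK D K)).Fibre (.inr pp)),
    haveI : Fact (pp : ℕ).Prime := ⟨pp.2⟩; kOf (pilotDataOfK D K) pp.1 x)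

/-! ## §1. Realising Θ-idele norms are constant over the places above a rational prime when `[F_mod : ℚ] = 1` -/

/-- **`‖t_{i,w}‖ = ‖t_{i,w'}‖` for all places `w, w'` of `K` over the same rational prime, for ANY realising Θ-idele `t`, when `[F_mod : ℚ] = 1`**
(given idele data `r` of `D`): both equal `‖t_{Θ,i,v̲}‖` at THE place `v̲` of `F_mod` over `p` (abc-iut-s2-p7 `norm_eq_norm_tΘ_of_realising`;
one place by abc-iut-c312-d1 `ValLine.placesOver_subsingleton_of_finrank_eq_one`). [cite: DupuyHilado2025, §3.4, §3.9]
[cite: Mochizuki2012, IUTchI Ex. 3.2 (iv) p. 71] [cite: CasselsFrohlichANT1967, Ch. VII Prop. 1.2 (ii)] -/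
theorem norm_realising_eq_of_finrank_eq_one (r : IdeleData D) (ht0 : ∀ pp i x, t pp i x ≠ 0)
    (hT : ∀ (pp : Nat.Primes) (i : Fin (pilotDataOfK D K).lstar) (x : (thetaIndex (pilotDataOfK D K)).Fibre (.inr pp)),
      haveI : Fact (pp : ℕ).Prime := ⟨pp.2⟩
      Real.log ‖t pp i x‖ = -((pilotDataOfK D K).thetaPilot i (placeOf (pilotDataOfK D K) pp.1 x)) *
        logNorm K (placeOf (pilotDataOfK D K) pp.1 x) / localDegree K (placeOf (pilotDataOfK D K) pp.1 x))
    (hF : Module.finrank ℚ (fieldOfModuli E) = 1)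
    (pp : Nat.Primes) (i : Fin (pilotDataOfK D K).lstar) (x y : (thetaIndex (pilotDataOfK D K)).Fibre (.inr pp)) :
    ‖t pp i x‖ = ‖t pp i y‖ := by
  haveI : Fact (pp : ℕ).Prime := ⟨pp.2⟩
  rw [norm_eq_norm_tΘ_of_realising D t r ht0 hT pp i x, norm_eq_norm_tΘ_of_realising D t r ht0 hT pp i y]
  have key : ∀ v w : placesOver (fieldOfModuli E) (pp : ℕ), v = w →
      ‖((r.tΘ pp.1 pp.2 i v : (((placeSection D).localFieldFamily pp.1 pp.2).k v)ˣ) :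
          ((placeSection D).localFieldFamily pp.1 pp.2).k v)‖ =
        ‖((r.tΘ pp.1 pp.2 i w : (((placeSection D).localFieldFamily pp.1 pp.2).k w)ˣ) :
          ((placeSection D).localFieldFamily pp.1 pp.2).k w)‖ := by
    rintro v w rfl
    rfl
  exact key _ _ (ValLine.placesOver_subsingleton_of_finrank_eq_one hF pp.1 _ _)

/-- The same given ANY volume input OF `D` (e.g. a genuine Θ-volume datum's `T.I`, `T.isVolumeInputOf`): idele data exist by abc-iut-S2's
`ThetaData.exists_eq_volumeInputOf`. [cite: DupuyHilado2025, §3.4, §3.9] [cite: Mochizuki2012, IUTchI Def. 3.1 p. 61–62] -/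
theorem norm_realising_eq_of_finrank_eq_one_of_isVolumeInputOf {I : ThetaVolumeInput (fieldOfModuli E) K}
    (hI : ThetaData.IsVolumeInputOf D I) (ht0 : ∀ pp i x, t pp i x ≠ 0)
    (hT : ∀ (pp : Nat.Primes) (i : Fin (pilotDataOfK D K).lstar) (x : (thetaIndex (pilotDataOfK D K)).Fibre (.inr pp)),
      haveI : Fact (pp : ℕ).Prime := ⟨pp.2⟩
      Real.log ‖t pp i x‖ = -((pilotDataOfK D K).thetaPilot i (placeOf (pilotDataOfK D K) pp.1 x)) *
        logNorm K (placeOf (pilotDataOfK D K) pp.1 x) / localDegree K (placeOf (pilotDataOfK D K) pp.1 x))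
    (hF : Module.finrank ℚ (fieldOfModuli E) = 1)
    (pp : Nat.Primes) (i : Fin (pilotDataOfK D K).lstar) (x y : (thetaIndex (pilotDataOfK D K)).Fibre (.inr pp)) :
    ‖t pp i x‖ = ‖t pp i y‖ :=
  norm_realising_eq_of_finrank_eq_one D t (ThetaData.exists_eq_volumeInputOf D hI).choose ht0 hT hF pp i x y

/-! ## §2. Hence (P) = (U) at the licence level at the K-level setting of `pilotDataOfK D K`, degree one -/

variable {logv : PadicLogs K} (hlog : LogvAnalytic logv)
  (M : Type) [Field M] [NumberField M]
  (archPk : ∀ (j : (thetaIndex (pilotDataOfK D K)).Label) (vQ : (thetaIndex (pilotDataOfK D K)).VQ), Set ((logShellsDH (pilotDataOfK D K) logv).Packet j vQ))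
  (archSub : ∀ (j : (thetaIndex (pilotDataOfK D K)).Label) (v : (thetaIndex (pilotDataOfK D K)).V),
    Set ((logShellsDH (pilotDataOfK D K) logv).Packet j ((thetaIndex (pilotDataOfK D K)).over v)))
  (Ψ : ℤ → ∀ v : (thetaIndex (pilotDataOfK D K)).V, v ∈ (thetaIndex (pilotDataOfK D K)).Vbad → Set ((logShellsDH (pilotDataOfK D K) logv).StarPacket v))
  (act : ℤ → ∀ v : (thetaIndex (pilotDataOfK D K)).V, v ∈ (thetaIndex (pilotDataOfK D K)).Vbad →
    (logShellsDH (pilotDataOfK D K) logv).StarPacket v → Module.End ℚ ((logShellsDH (pilotDataOfK D K) logv).StarPacket v))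
  (Mmod : ℤ → ∀ j : (thetaIndex (pilotDataOfK D K)).LabelStar, Set ((logShellsDH (pilotDataOfK D K) logv).GlobalPacket j.1))
  (region : ℤ → ∀ j : (thetaIndex (pilotDataOfK D K)).LabelStar, FinDivisor M → ∀ vQ : (thetaIndex (pilotDataOfK D K)).VQ,
    Set ((logShellsDH (pilotDataOfK D K) logv).Packet j.1 vQ))
  (n : ℤ) {HT : Type} {LogLink : HT → HT → Type} {IsFull : ∀ {s t : HT}, LogLink s t → Prop}
  (lat : LGPGaussianLogThetaLattice LogLink IsFull)
  {Frd : Type} {IsoF : Frd → Frd → Type} {Ob : Frd → Type} {realify : Frd → Frd} {Strip : Type}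
  {IsoS : Strip → Strip → Type} {Mv : ∀ v : (thetaIndex (pilotDataOfK D K)).V, v ∈ (thetaIndex (pilotDataOfK D K)).Vbad → Type}
  [∀ v h, Monoid (Mv v h)]
  (sig : GlobalLGPFrobenioidSignature (thetaIndex (pilotDataOfK D K)).lstar (thetaIndex (pilotDataOfK D K)).V (· ∈ (thetaIndex (pilotDataOfK D K)).Vbad)
    Frd IsoF Ob realify Strip IsoS Mv)
  (split : SplittingMonoids Mv) {ObΔ : Type} {N : ∀ v : (thetaIndex (pilotDataOfK D K)).V, v ∈ (thetaIndex (pilotDataOfK D K)).Vbad → Type}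
  [∀ v h, Monoid (N v h)] (qData : QPilotData ObΔ N)
  (tq : ∀ (pp : Nat.Primes) (x : (thetaIndex (pilotDataOfK D K)).Fibre (.inr pp)), haveI : Fact (pp : ℕ).Prime := ⟨pp.2⟩; kOf (pilotDataOfK D K) pp.1 x)
  (htq0 : ∀ pp x, tq pp x ≠ 0)
  (htq1 : ∀ (pp : Nat.Primes) (x : (thetaIndex (pilotDataOfK D K)).Fibre (.inr pp)),
    haveI : Fact (pp : ℕ).Prime := ⟨pp.2⟩; placeOf (pilotDataOfK D K) pp.1 x ∉ (pilotDataOfK D K).S → ‖tq pp x‖ = 1)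


/-- **`SlotLicence ↔ Licence` at the K-level setting of `pilotDataOfK D K` when `[F_mod : ℚ] = 1`**, for ANY context binders, ANY q-ideles and
ANY non-zero realising Θ-ideles (p475870's `slotLicence_iff_licence_settingPrVolSharp_of_norm_const` with `hΘ` discharged by §1).
[cite: Mochizuki2012, IUTchIII Cor. 3.12 Step (xi-f) p. 184; Thm. 3.11 (i) (Ind1) p. 154] [cite: DupuyHilado2025, §3.9, §4.11–4.12] -/
theorem slotLicence_iff_licence_settingPrVolSharp_pilotDataOfK_of_finrank_eq_one (r : IdeleData D) (ht0 : ∀ pp i x, t pp i x ≠ 0)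
    (hT : ∀ (pp : Nat.Primes) (i : Fin (pilotDataOfK D K).lstar) (x : (thetaIndex (pilotDataOfK D K)).Fibre (.inr pp)),
      haveI : Fact (pp : ℕ).Prime := ⟨pp.2⟩
      Real.log ‖t pp i x‖ = -((pilotDataOfK D K).thetaPilot i (placeOf (pilotDataOfK D K) pp.1 x)) *
        logNorm K (placeOf (pilotDataOfK D K) pp.1 x) / localDegree K (placeOf (pilotDataOfK D K) pp.1 x))
    (hF : Module.finrank ℚ (fieldOfModuli E) = 1) :
    (settingPrVolSharp (pilotDataOfK D K) hlog M archPk archSub Ψ act Mmod region n lat sig split qData tq t htq0 htq1).SlotLicence ↔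
      Thm311ToCor312.Licence (settingPrVolSharp (pilotDataOfK D K) hlog M archPk archSub Ψ act Mmod region n lat sig split qData tq t htq0 htq1) :=
  slotLicence_iff_licence_settingPrVolSharp_of_norm_const (pilotDataOfK D K) hlog M archPk archSub Ψ act Mmod region n lat sig split qData t tq htq0 htq1 ht0
    (norm_realising_eq_of_finrank_eq_one D t r ht0 hT hF)

/-- Contrapositive: at degree one **a failure of the SLOT licence (the antecedent of the K γ binders) is a failure of the (U) licence** — hence
of the q-pinned S_H (abc-iut-w5-d068 `licence_of_pilotKummerCompatHull`). [folklore] -/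
theorem not_licence_of_not_slotLicence_settingPrVolSharp_pilotDataOfK_of_finrank_eq_one (r : IdeleData D)
    (ht0 : ∀ pp i x, t pp i x ≠ 0)
    (hT : ∀ (pp : Nat.Primes) (i : Fin (pilotDataOfK D K).lstar) (x : (thetaIndex (pilotDataOfK D K)).Fibre (.inr pp)),
      haveI : Fact (pp : ℕ).Prime := ⟨pp.2⟩
      Real.log ‖t pp i x‖ = -((pilotDataOfK D K).thetaPilot i (placeOf (pilotDataOfK D K) pp.1 x)) *
        logNorm K (placeOf (pilotDataOfK D K) pp.1 x) / localDegree K (placeOf (pilotDataOfK D K) pp.1 x))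
    (hF : Module.finrank ℚ (fieldOfModuli E) = 1)
    (hns : ¬ (settingPrVolSharp (pilotDataOfK D K) hlog M archPk archSub Ψ act Mmod region n lat sig split qData tq t htq0 htq1).SlotLicence) :
    ¬ Thm311ToCor312.Licence (settingPrVolSharp (pilotDataOfK D K) hlog M archPk archSub Ψ act Mmod region n lat sig split qData tq t htq0 htq1) :=
  not_licence_of_not_slotLicence_settingPrVolSharp_of_norm_const (pilotDataOfK D K) hlog M archPk archSub Ψ act Mmod region n lat sig split qData t tq htq0 htq1 ht0
    (norm_realising_eq_of_finrank_eq_one D t r ht0 hT hF) hns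

/-- The same two with the idele data supplied by ANY volume input OF `D` (`ThetaData.exists_eq_volumeInputOf`). [folklore] -/
theorem slotLicence_iff_licence_settingPrVolSharp_pilotDataOfK_of_finrank_eq_one_of_isVolumeInputOf
    {I : ThetaVolumeInput (fieldOfModuli E) K} (hI : ThetaData.IsVolumeInputOf D I) (ht0 : ∀ pp i x, t pp i x ≠ 0)
    (hT : ∀ (pp : Nat.Primes) (i : Fin (pilotDataOfK D K).lstar) (x : (thetaIndex (pilotDataOfK D K)).Fibre (.inr pp)),
      haveI : Fact (pp : ℕ).Prime := ⟨pp.2⟩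
      Real.log ‖t pp i x‖ = -((pilotDataOfK D K).thetaPilot i (placeOf (pilotDataOfK D K) pp.1 x)) *
        logNorm K (placeOf (pilotDataOfK D K) pp.1 x) / localDegree K (placeOf (pilotDataOfK D K) pp.1 x))
    (hF : Module.finrank ℚ (fieldOfModuli E) = 1) :
    (settingPrVolSharp (pilotDataOfK D K) hlog M archPk archSub Ψ act Mmod region n lat sig split qData tq t htq0 htq1).SlotLicence ↔
      Thm311ToCor312.Licence (settingPrVolSharp (pilotDataOfK D K) hlog M archPk archSub Ψ act Mmod region n lat sig split qData tq t htq0 htq1) :=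
  slotLicence_iff_licence_settingPrVolSharp_pilotDataOfK_of_finrank_eq_one D t hlog M archPk archSub Ψ act Mmod region n lat sig split qData
    tq htq0 htq1 (ThetaData.exists_eq_volumeInputOf D hI).choose ht0 hT hF

end Summit.ABC.IUTFork.Cor312Prov

end
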